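import Summits.CriticalPhenomena.PercolationContinuityZ3.Theorems.Transplant.SkelConcFaceRegion
import Summits.CriticalPhenomena.PercolationContinuityZ3.Theorems.Transplant.KNCellsBoxProdZ2InnerRun
import HarnessLib

/-!
# L6 (F) — PLANAR GEOMETRY OF THE INNER RUN of a face-step contact for the SHRUNK far rows `PCells.farAS` (generic re-typing of the planar
# halves of `KNCellsBoxProdZ2InnerRun.innerRun_regionR_subset_farA` and `BoxProdZ2ConcFaceRoute.innerRunOK_contact`, SHEAR-SCOPE §3.9 Layer 6 (F))

builds on p205010 (kernel theorem, internal audit signed; external expert review pending) — nothing in this file uses p205010.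
Lane `prim-bschramm`, typed by the `prim-hp-8` lineage (gen 24); helper file (`--supports stmt-CriticalPhenomena-4575 --as helper`).
NEW FILE over `SkelConcFaceRegion` (part 1: `farAS`, the shifted face row) and p2's planar `KNCellsBoxProdZ2InnerRun` (`InnerRunOK`, `innerCtr`,
`innerρ`, imported verbatim).  Pure `Site 2`; no skeleton structure.

Over a planar skeleton the face-step region is the plain window over `farAS x du j` (levels `≥ 5r + 10 s j + 2`, `≤ 25 r − 1`, transverse
half-width `5 r − 2`) and the face row is shifted to planar level `5r + 10 s (j+1) − 1`; the elongated inner run of a deep contact (KN Lemma 11)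
must therefore sit in `farAS`, which costs two inequalities beyond p2's `InnerRunOK` (`hlo₂`, `htr₂` below) — both with the slack the per-contact
parameters already have (`innerRunOK_contact_shifted`: region `0` starts `10 s − Rlev + M ≥ 2` rows above the stub top; transversally `3 r ≤ 5 r − 2`).
* **`innerRun_regionR_subset_farAS`** — every rooted region of the inner run lies in `farAS x du j`;
* **`innerRunOK_contact_shifted`** — the per-contact parameters (`ca = lv + ℓ1`, `nA = ⌊(17r − ca)⁺/s₁⌋`) for a cube centre at signed level
  `lv ∈ [5r + 10 s (j+1) − 1 − Rlev, 5r + 10 s (j+1) − 1 + Rlev]`, transverse offset `|b| ≤ 2r + Rlev`: `InnerRunOK`, `nA ≤ nmax`, the two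
  `farAS` inequalities, the first-hop square `(lv, b) + Λ_{ℓ1}` inside the rows / columns of `farAS`, and region `0` above the kit cube.
[cite: KozmaNitzan2024, §4 Lemma 11 (pp. 22–23: the slabs of Ω), p. 30 (Step III)]
-/

noncomputable section

namespace Summit.CriticalPhenomena.PercolationContinuityZ3.Theorems

namespace Transplant

namespace PCells

open Literature.Probability.Percolation Literature.Probability.LatticeModels
open Literature.Probability.Percolation.KozmaNitzan
open Literature.Probability.Percolation.KozmaNitzan.Cells (oth oth_ne eq_oth_of_ne sgOf sgOf_sign stepVec_apply_fst stepVec_apply_oth)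
open KNCells ChainPlanar
open BoxProdZ2 (InnerRunOK innerCtr innerρ innerCtr_fst innerCtr_oth sg_mul_sub_add innerRun_advOK)

variable (C : PCells)

/-- **Every rooted region of the inner run lies in the shrunk far rows `farAS x du j`** (`k ≤ nA`), given p2's `InnerRunOK` and the two
`farAS` margins: region `0` starts at level `≥ 5r + 10 s j + 2` (`hlo₂`) and the transverse extent is `≤ 5 r − 2` (`htr₂`).
[cite: KozmaNitzan2024, §4 Lemma 11 (p. 22: Ω), p. 30] -/
theorem innerRun_regionR_subset_farAS {x : Site 2} {du : MDir} {j : ℕ} {s₁ : ℤ} {R' ℓ₀ nA : ℕ} {ca cb q' : ℤ}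
    (h : InnerRunOK C j s₁ R' ℓ₀ nA ca cb q') (hlo₂ : 5 * (C.r : ℤ) + 10 * C.s * j + 2 + s₁ + 2 * R' ≤ ca)
    (htr₂ : |cb| + q' + 2 * s₁ + ((nA : ℤ) + 3) * R' ≤ 5 * (C.r : ℤ) - 2) {k : ℕ} (hk : k ≤ nA) :
    Adv.regionR 0 s₁ (innerρ q' s₁ R' nA) R' du.1 (sgOf du) (innerCtr C x du ca cb) k ⊆ C.farAS x du j := by
  intro y hy
  have hy' := Adv.regionR_subset_prism (sgOf_sign du) (innerCtr C x du ca cb) (innerRun_advOK h) hk hy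
  rw [PCells.mem_psBox_iff] at hy'
  simp only [innerCtr_fst, innerCtr_oth, sg_mul_sub_add, Adv.ρ₀] at hy'
  obtain ⟨⟨hl1, hl2⟩, hb1, hb2⟩ := hy'
  have hfar2 := h.hfar2; have hq' := h.hq'
  have hR0 : (0 : ℤ) ≤ R' := by positivity
  have hN0 : (0 : ℤ) ≤ nA := by positivity
  have hNR : (0 : ℤ) ≤ (nA : ℤ) * R' := by positivity
  unfold innerρ at hb1 hb2
  push_cast at hl1 hl2
  have hcb := le_abs_self cb
  have hcb' := neg_abs_le cb
  have hr1 : (1 : ℤ) ≤ C.r := by exact_mod_cast C.one_le_r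
  rw [PCells.farAS, PCells.mem_psBox_iff]
  refine ⟨⟨by linarith, by linarith⟩, by linarith, by linarith⟩

/-- **The per-contact parameters of the inner run, shifted face row and shrunk region.**  For a contact whose cube centre has signed level
`lv ∈ [5r + 10s(j+1) − 1 − Rlev, 5r + 10s(j+1) − 1 + Rlev]` and transverse offset `|b| ≤ 2r + Rlev`: with `ca = lv + ℓ1` and
`nA = ⌊(17r − ca)⁺ / s₁⌋`, `InnerRunOK C j s₁ R' ℓ₀ nA ca b ℓ1` holds with `nA ≤ nmax`, the two `farAS` margins of
`innerRun_regionR_subset_farAS` hold, the first-hop square `(lv, b) + Λ_{ℓ1}` lies in the rows `[5r + 10 s j + 2, 25 r − 1]` and columns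
`[−(5r − 2), 5r − 2]` of `farAS`, and the rooted regions start above the kit cube (`lv + M < ca − (s₁ + 2R')`).
[cite: KozmaNitzan2024, §4 Lemma 11 (pp. 22–23), p. 30 (Step III)] -/
theorem innerRunOK_contact_shifted {j : ℕ} (hjK : j + 1 ≤ C.K) {s₁ R' ℓ₀ ℓ1 Rlev M nmax : ℕ} (hMℓ : M < ℓ₀)
    (hs : R' + ℓ₀ ≤ s₁) (hs2 : 2 * R' ≤ s₁) (hℓ1 : M + s₁ + 2 * R' + 1 ≤ ℓ1) (hn : 12 * C.r ≤ nmax * s₁)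
    (hbig : Rlev + ℓ1 + 2 * s₁ + (nmax + 3) * R' ≤ C.r) (h10s : Rlev + ℓ1 + 3 ≤ 10 * C.s) {lv b : ℤ}
    (hlv1 : 5 * (C.r : ℤ) + 10 * C.s * (j + 1 : ℕ) - 1 - Rlev ≤ lv) (hlv2 : lv ≤ 5 * (C.r : ℤ) + 10 * C.s * (j + 1 : ℕ) - 1 + Rlev)
    (hb : |b| ≤ 2 * (C.r : ℤ) + Rlev) :
    let ca : ℤ := lv + ℓ1
    let nA : ℕ := (17 * (C.r : ℤ) - ca).toNat / s₁
    InnerRunOK C j (s₁ : ℤ) R' ℓ₀ nA ca b (ℓ1 : ℤ) ∧ nA ≤ nmax ∧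
      (5 * (C.r : ℤ) + 10 * C.s * j + 2 + s₁ + 2 * R' ≤ ca ∧ |b| + (ℓ1 : ℤ) + 2 * s₁ + ((nA : ℤ) + 3) * R' ≤ 5 * (C.r : ℤ) - 2) ∧
      (5 * (C.r : ℤ) + 10 * C.s * j + 2 ≤ lv - ℓ1 ∧ lv + ℓ1 ≤ 25 * (C.r : ℤ) - 1 ∧
        -(5 * (C.r : ℤ) - 2) ≤ b - ℓ1 ∧ b + ℓ1 ≤ 5 * (C.r : ℤ) - 2) ∧
      lv + M < ca - ((s₁ : ℤ) + 2 * R') := by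
  intro ca nA
  -- linear bookkeeping (all in `ℤ`)
  have hsj : (C.s : ℤ) * j + C.s ≤ C.r := by
    have h := Nat.mul_le_mul_left C.s hjK
    rw [Nat.mul_comm C.s C.K] at h
    have : ((C.s * (j + 1) : ℕ) : ℤ) ≤ C.r := by exact_mod_cast (show C.s * (j + 1) ≤ C.r from h)
    push_cast at this; linarith
  have hsj0 : 0 ≤ (C.s : ℤ) * j := by positivity
  have e1 : 10 * (C.s : ℤ) * ((j + 1 : ℕ) : ℤ) = 10 * ((C.s : ℤ) * j) + 10 * C.s := by push_cast; ring
  rw [e1] at hlv1 hlv2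
  have hs1 : 1 ≤ s₁ := by omega
  have hs0 : 0 < s₁ := hs1
  have hbig' : (Rlev : ℤ) + ℓ1 + 2 * s₁ + (nmax * R' + 3 * R') ≤ C.r := by
    have : ((Rlev + ℓ1 + 2 * s₁ + (nmax + 3) * R' : ℕ) : ℤ) ≤ C.r := by exact_mod_cast hbig
    push_cast at this; linarith
  have h10s' : (Rlev : ℤ) + ℓ1 + 3 ≤ 10 * C.s := by exact_mod_cast h10s
  have hℓ1' : (M : ℤ) + s₁ + 2 * R' + 1 ≤ ℓ1 := by exact_mod_cast hℓ1
  have hs' : (R' : ℤ) + ℓ₀ ≤ s₁ := by exact_mod_cast hs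
  have hs2' : 2 * (R' : ℤ) ≤ s₁ := by exact_mod_cast hs2
  have hn' : 12 * (C.r : ℤ) ≤ nmax * s₁ := by exact_mod_cast hn
  have hR0 : (0 : ℤ) ≤ R' := by positivity
  have hnR0 : (0 : ℤ) ≤ (nmax : ℤ) * R' := by positivity
  have hr1 : (1 : ℤ) ≤ C.r := by exact_mod_cast C.one_le_r
  have hbabs := le_abs_self b
  have hbabs' := neg_abs_le b
  have habs0 := abs_nonneg b
  have hca5 : 5 * (C.r : ℤ) ≤ ca := by change _ ≤ lv + ℓ1; linarith
  have hca15 : ca ≤ 15 * (C.r : ℤ) + Rlev + ℓ1 := by change lv + ℓ1 ≤ _; linarith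
  -- the number of advance steps
  set d : ℕ := (17 * (C.r : ℤ) - ca).toNat with hd
  have hd1 : 17 * (C.r : ℤ) - ca ≤ d := Int.self_le_toNat _
  have hd2 : (d : ℤ) = max (17 * (C.r : ℤ) - ca) 0 := Int.toNat_eq_max _
  have hnA1 : ((nA * s₁ : ℕ) : ℤ) ≤ d := by exact_mod_cast Nat.div_mul_le_self d s₁
  have hnA2 : (d : ℤ) < ((nA * s₁ + s₁ : ℕ) : ℤ) := by exact_mod_cast Nat.lt_div_mul_add hs0
  push_cast at hnA1 hnA2
  have hd12 : (d : ℤ) ≤ 12 * C.r := by rw [hd2]; exact max_le (by linarith) (by positivity)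
  have hdca : ca + (d : ℤ) ≤ 17 * C.r + Rlev + ℓ1 := by
    rw [hd2]; have : max (17 * (C.r : ℤ) - ca) 0 ≤ 17 * C.r + Rlev + ℓ1 - ca := max_le (by linarith) (by linarith)
    linarith
  have hnAmax : nA ≤ nmax := by
    have h1 : (nA : ℤ) * s₁ ≤ nmax * s₁ := by linarith
    have h2 : (nA : ℤ) ≤ nmax := le_of_mul_le_mul_right h1 (by exact_mod_cast hs0)
    exact_mod_cast h2
  have hnR : (nA : ℤ) * R' ≤ nmax * R' := mul_le_mul_of_nonneg_right (by exact_mod_cast hnAmax) hR0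
  have htr₂ : |b| + (ℓ1 : ℤ) + 2 * s₁ + ((nA : ℤ) + 3) * R' ≤ 5 * (C.r : ℤ) - 2 := by
    have : |b| + (ℓ1 : ℤ) + 2 * s₁ + ((nA : ℤ) + 3) * R' = |b| + ℓ1 + 2 * s₁ + (nA * R' + 3 * R') := by ring
    rw [this]; linarith
  refine ⟨⟨by positivity, hs', hs2', ?_, ?_, ?_, ?_, ?_⟩, hnAmax, ⟨?_, htr₂⟩, ⟨by linarith, by linarith, by linarith, by linarith⟩, ?_⟩
  · -- region `0` above the stub
    change _ ≤ lv + ℓ1; linarith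
  · -- the far face at least at `17 r`
    have : ca + ((nA : ℤ) + 1) * s₁ = ca + (nA * s₁ + s₁) := by ring
    rw [this]; linarith
  · -- the far face at most at `23 r`
    have : ca + ((nA : ℤ) + 1) * s₁ = ca + (nA * s₁ + s₁) := by ring
    rw [this]; linarith
  · -- the regions inside `farA` transversally (p2's field; weaker than `htr₂`)
    linarith
  · -- the far face inside `M(x+du)` transversally
    have : |b| + (ℓ1 : ℤ) + s₁ + ((nA : ℤ) + 2) * R' = |b| + ℓ1 + s₁ + (nA * R' + 2 * R') := by ring
    rw [this]; linarith
  · -- region `0` above row `5r + 10 s j + 1` (the `farAS` margin)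
    change _ ≤ lv + ℓ1; linarith
  · change lv + M < lv + ℓ1 - _; linarith

end PCells

end Transplant

end Summit.CriticalPhenomena.PercolationContinuityZ3.Theorems

end
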